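import Mathlib.Data.Real.Basic
import Mathlib.Tactic
import HarnessLib

/-!
# What a two-grid agreement certifies: the geometric-tail bound under a contraction hypothesis, and nothing without one

Cell `pub-fluidc` (FLUID COMPUTER; host summit `NavierStokesRegularity`, negation side, machine paradigm), prover
seat p1 (gen 7) — the seat that runs the cell's second-engine / second-grid CERTIFICATES (R8K: Φ₂₅₆ vs Φ₁₂₈; R3 rows:
96 / 128 / 192 / 256 spreads; RULING R25 (iii) CERT marks `|Δ| ≤ 2 %` between `N` and `2N`). HONEST FRAMING: low prior,
high value-of-information experiment on Tao's machine paradigm; NOT a claim that NS blows up. Nothing here is about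
the Navier–Stokes equations; it is the elementary bookkeeping that says precisely WHAT a grid-refinement agreement
certifies, so that the cell's words 'certified at 2N' are read for what they are.

Objects: a target value `s` (the continuum number), a coarse approximant `a` (grid `N`) and a fine one `b` (grid `2N`).
* `Contracts θ s a b` — the CONTRACTION HYPOTHESIS `|s − b| ≤ θ · |s − a|` (the fine error is at most `θ` times the
  coarse error; `θ = 2^{-p}` on the exact order-`p` model of `Literature.Analysis.Quadrature.richardsonStep_exact`).
* `coarse_error_le` / `fine_error_le` — under `Contracts θ` with `θ < 1`: `|s − a| ≤ |b − a| / (1 − θ)` and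
  `|s − b| ≤ θ/(1 − θ) · |b − a|` (geometric tail): the OBSERVED two-grid difference bounds the UNOBSERVED distance to
  the truth, with the factor `1` at `θ = 1/2` (`fine_error_le_of_half`) and `1/3` at `θ = 1/4` (`fine_error_le_of_quarter`,
  second-order halving);
* `third_error_le` — three grids: two contraction steps put the finest value within `θ²/(1 − θ) · |b − a|`;
* `fine_error_le_rel` — the relative form the marks use (`|b − a| ≤ ε |b| ⟹ |s − b| ≤ θ/(1−θ) · ε · |b|`);
* `contracts_of_model` — the hypothesis holds on the signed model `s − b = q · (s − a)`, `|q| ≤ θ`;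
* `truth_unconstrained_without_contraction` — the CAVEAT, stated as a (trivial) theorem so that it is on the record:
  for ANY observed pair `(a, b)` and ANY `e ≥ 0` there is a value `s` at distance exactly `e` from `b`; an agreement
  between two grids (or two engines) bounds the distance to the continuum ONLY through a contraction / convergence-order
  hypothesis, which the cell's certificates ASSUME (spectral convergence of resolved runs) and do not prove.
0 sorry; no named fact introduced.
-/

namespace Summit.NavierStokesRegularity.FluidComputer.GridContraction

/-- CONTRACTION HYPOTHESIS between a coarse approximant `a` and a fine approximant `b` of the value `s`:
`|s − b| ≤ θ · |s − a|`. -/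
def Contracts (θ s a b : ℝ) : Prop := |s - b| ≤ θ * |s - a|

/-- Under contraction with `θ < 1`, the coarse error is controlled by the observed difference:
`|s − a| ≤ |b − a| / (1 − θ)`. -/
theorem coarse_error_le {θ s a b : ℝ} (hθ : θ < 1) (h : Contracts θ s a b) :
    |s - a| ≤ |b - a| / (1 - θ) := by
  unfold Contracts at h
  have htri : |s - a| ≤ |s - b| + |b - a| := by
    have := abs_sub_le s b a
    linarith
  rw [le_div_iff₀ (by linarith)]
  nlinarith

/-- GEOMETRIC TAIL: under contraction with `0 ≤ θ < 1`, the fine error is at most `θ/(1−θ)` times the observed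
two-grid difference, `|s − b| ≤ θ/(1 − θ) · |b − a|`. -/
theorem fine_error_le {θ s a b : ℝ} (hθ0 : 0 ≤ θ) (hθ : θ < 1) (h : Contracts θ s a b) :
    |s - b| ≤ θ / (1 - θ) * |b - a| := by
  have hc := coarse_error_le hθ h
  unfold Contracts at h
  calc |s - b| ≤ θ * |s - a| := h
    _ ≤ θ * (|b - a| / (1 - θ)) := mul_le_mul_of_nonneg_left hc hθ0
    _ = θ / (1 - θ) * |b - a| := by ring

/-- First-order halving (`θ = 1/2`): the observed difference IS the bound, `|s − b| ≤ |b − a|`. -/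
theorem fine_error_le_of_half {s a b : ℝ} (h : Contracts (1 / 2) s a b) : |s - b| ≤ |b - a| := by
  have := fine_error_le (by norm_num) (by norm_num) h
  norm_num at this
  exact this

/-- Second-order halving (`θ = 1/4`): `|s − b| ≤ |b − a| / 3`. -/
theorem fine_error_le_of_quarter {s a b : ℝ} (h : Contracts (1 / 4) s a b) : |s - b| ≤ |b - a| / 3 := by
  have := fine_error_le (by norm_num) (by norm_num) h
  norm_num at this
  linarith

/-- THREE GRIDS: two contraction steps `a → b → c` put the finest value within `θ²/(1−θ) · |b − a|` of the truth. -/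
theorem third_error_le {θ s a b c : ℝ} (hθ0 : 0 ≤ θ) (hθ : θ < 1) (h1 : Contracts θ s a b)
    (h2 : Contracts θ s b c) : |s - c| ≤ θ ^ 2 / (1 - θ) * |b - a| := by
  have hb := fine_error_le hθ0 hθ h1
  unfold Contracts at h2
  calc |s - c| ≤ θ * |s - b| := h2
    _ ≤ θ * (θ / (1 - θ) * |b - a|) := mul_le_mul_of_nonneg_left hb hθ0
    _ = θ ^ 2 / (1 - θ) * |b - a| := by ring

/-- RELATIVE FORM (the one the marks use): a relative two-grid agreement `|b − a| ≤ ε · |b|` certifies, under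
contraction, `|s − b| ≤ θ/(1−θ) · ε · |b|`. -/
theorem fine_error_le_rel {θ s a b ε : ℝ} (hθ0 : 0 ≤ θ) (hθ : θ < 1) (h : Contracts θ s a b)
    (hrel : |b - a| ≤ ε * |b|) : |s - b| ≤ θ / (1 - θ) * ε * |b| := by
  have hk : 0 ≤ θ / (1 - θ) := div_nonneg hθ0 (by linarith)
  calc |s - b| ≤ θ / (1 - θ) * |b - a| := fine_error_le hθ0 hθ h
    _ ≤ θ / (1 - θ) * (ε * |b|) := mul_le_mul_of_nonneg_left hrel hk
    _ = θ / (1 - θ) * ε * |b| := by ring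

/-- The hypothesis on the signed model: if the fine error is a multiple `q` of the coarse error with `|q| ≤ θ`
(`q = 2^{-p}` on the exact order-`p` model, `q = −2^{-p}` for an alternating one), contraction holds. -/
theorem contracts_of_model {θ s a b q : ℝ} (hq : |q| ≤ θ) (hmodel : s - b = q * (s - a)) :
    Contracts θ s a b := by
  unfold Contracts
  rw [hmodel, abs_mul]
  exact mul_le_mul_of_nonneg_right hq (abs_nonneg _)

/-- Monotonicity in the hypothesis: a contraction with a smaller factor is one with a larger factor. -/
theorem Contracts.mono {θ θ' s a b : ℝ} (h : Contracts θ s a b) (hθ : θ ≤ θ') : Contracts θ' s a b := by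
  unfold Contracts at h ⊢
  exact h.trans (mul_le_mul_of_nonneg_right hθ (abs_nonneg _))

/-- THE CAVEAT, on the record: without a contraction hypothesis an observed pair `(a, b)` constrains the truth not at
all — whatever the coarse value was, for every `e ≥ 0` some value `s` sits at distance exactly `e` from the fine
approximant `b`. Two grids (or two
engines) that agree certify the distance to the continuum only THROUGH `Contracts`, which the cell's certificates
assume (spectral convergence of resolved runs), not prove. -/
theorem truth_unconstrained_without_contraction (b e : ℝ) (he : 0 ≤ e) : ∃ s : ℝ, |s - b| = e :=
  ⟨b + e, by rw [add_sub_cancel_left, abs_of_nonneg he]⟩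

/-! ### A worked instance in the cell's units -/

/-- The R25 (iii) mark at second order: a `2 %` agreement between `N` and `2N` (`|b − a| ≤ 0.02 |b|`) certifies the
`2N` value to `2/3 %` of itself under second-order halving (`θ = 1/4`), and to `2 %` under first-order (`θ = 1/2`). -/
theorem mark_two_percent {s a b : ℝ} (hrel : |b - a| ≤ 0.02 * |b|) :
    (Contracts (1 / 4) s a b → |s - b| ≤ 0.02 / 3 * |b|) ∧ (Contracts (1 / 2) s a b → |s - b| ≤ 0.02 * |b|) := by
  constructor
  · intro h
    have := fine_error_le_rel (by norm_num) (by norm_num) h hrel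
    norm_num at this
    linarith
  · intro h
    have := fine_error_le_rel (by norm_num) (by norm_num) h hrel
    norm_num at this
    linarith

/-! ### The 256³ → 384³ step: grid ratio `3/2` (p1 gen 8; registered before the 384³ legs kit j229414 / j232158 land)

Everything above is worded for a halving (`θ = 2^{-p}`). The cell's 3N certification legs refine `256³ → 384³`,
ratio `3/2`: on the exact order-`p` model `s − a_N = C · N^{-p}` the step contracts by `θ = (2/3)^p` — `2/3`, `4/9`,
`8/27`, `16/81` at orders 1–4 — and the geometric-tail factor `θ/(1 − θ)` of `fine_error_le` is `2`, `4/5`, `8/19`,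
`16/65`. So, UNDER the model: the observed 256↔384 difference bounds the 384³ value's distance to the continuum by
itself (`factor ≤ 1`) from order 2 on, NOT at order 1 (factor 2); and the R25 (iii) `2 %` mark read at ratio `3/2`
certifies `1.6 %` at order 2 and `0.5 %` at order 4. Which order (if any) governs a marginally resolved pseudo-spectral
run is an empirical question the pair does not answer (`truth_unconstrained_without_contraction`). -/

/-- The order-`p` model at ratio `3/2` is a contraction with `θ = (2/3)^p`. -/
theorem contracts_ratio32_of_model {s a b : ℝ} (p : ℕ) (hmodel : s - b = (2 / 3 : ℝ) ^ p * (s - a)) :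
    Contracts ((2 / 3 : ℝ) ^ p) s a b :=
  contracts_of_model (by rw [abs_of_nonneg (by positivity)]) hmodel

/-- Ratio `3/2`, ORDER 1 (`θ = 2/3`): the tail factor is `2` — the truth may sit TWICE the observed difference away
from the fine value; a bare agreement is not yet a certificate at first order. -/
theorem fine_error_le_ratio32_order1 {s a b : ℝ} (h : Contracts (2 / 3) s a b) : |s - b| ≤ 2 * |b - a| := by
  have := fine_error_le (by norm_num) (by norm_num) h
  norm_num at this
  exact this

/-- Ratio `3/2`, ORDER 2 (`θ = 4/9`): `|s − b| ≤ 4/5 · |b − a|`. -/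
theorem fine_error_le_ratio32_order2 {s a b : ℝ} (h : Contracts (4 / 9) s a b) : |s - b| ≤ 4 / 5 * |b - a| := by
  have := fine_error_le (by norm_num) (by norm_num) h
  norm_num at this
  exact this

/-- Ratio `3/2`, ORDER 4 (`θ = 16/81`): `|s − b| ≤ 16/65 · |b − a|`. -/
theorem fine_error_le_ratio32_order4 {s a b : ℝ} (h : Contracts (16 / 81) s a b) :
    |s - b| ≤ 16 / 65 * |b - a| := by
  have := fine_error_le (by norm_num) (by norm_num) h
  norm_num at this
  exact this

/-- Where the ratio-`3/2` step becomes self-certifying: `(2/3)^p ≤ 1/2` (tail factor `≤ 1`) holds at `p = 2` and fails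
at `p = 1`. -/
theorem ratio32_half_threshold : (2 / 3 : ℝ) ^ 2 ≤ 1 / 2 ∧ ¬ (2 / 3 : ℝ) ^ 1 ≤ 1 / 2 := by
  constructor <;> norm_num

/-- The `2 %` mark READ AT RATIO `3/2`: a 256↔384 agreement `|b − a| ≤ 0.02·|b|` certifies the 384³ value to `1.6 %`
of itself at order 2 and to `0.5 %` at order 4 (under the respective contraction); at order 1 only to `4 %`. -/
theorem mark_two_percent_ratio32 {s a b : ℝ} (hrel : |b - a| ≤ 0.02 * |b|) :
    (Contracts (4 / 9) s a b → |s - b| ≤ 0.016 * |b|) ∧ (Contracts (16 / 81) s a b → |s - b| ≤ 0.005 * |b|) ∧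
      (Contracts (2 / 3) s a b → |s - b| ≤ 0.04 * |b|) := by
  refine ⟨fun h => ?_, fun h => ?_, fun h => ?_⟩
  · have := fine_error_le_rel (by norm_num) (by norm_num) h hrel
    norm_num at this
    linarith
  · have := fine_error_le_rel (by norm_num) (by norm_num) h hrel
    norm_num at this
    linarith [abs_nonneg b]
  · have := fine_error_le_rel (by norm_num) (by norm_num) h hrel
    norm_num at this
    linarith

/-! ### The TEMPORAL ladder of STEP-0 (p1 gen 9): dt-halving of p1spec's RK4 at 128³ on the rung of record

HOME paper §P.4 (1) / `atlas/rung-next/step0-p1/README.md` (kit j173873): the same forward problem (ℰ₀ 4000 optimum of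
record, T fixed) stepped with `n = 602 / 1204 / 2408` equal RK4 steps gave growth `18.602344972 / 18.602324622 / 18.602323240`;
printed: "Richardson(dt→0) 18.602323148, observed temporal order 3.88 (RK4's 4)". Here those words are arithmetic on the
three numbers: the successive differences `2.035·10⁻⁵`, `1.382·10⁻⁶` contract by the OBSERVED factor `θ_obs = 0.0679`
(`1/θ_obs = 14.7`, i.e. `2^3.88`; the exact order-4 model would give `1/16`), the order-4 Richardson value from the fine pair is
`(16·s₂₄₀₈ − s₁₂₀₄)/15 = 18.6023231479`, and UNDER a contraction hypothesis at the observed rate (`θ = 1/14 ≥ θ_obs`) the finest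
value is within `1.1·10⁻⁷` (relative `6·10⁻⁹`) of the dt → 0 limit — four orders below the cell's 2 % marks and below the
two-code spread at 256³ (`1.5·10⁻⁷`). The typed order statement behind 'RK4's 4' is
`Literature.Analysis.ODE.RungeKuttaOrderConditions.rk4_orderConds4` (+ HNW Thm. 2.13, cited there). -/

/-- STEP-0's three dt-halving values (n = 602, 1204, 2408 RK4 steps; kit j173873). -/
def s602 : ℝ := 18.602344972
/-- see `s602`. -/
def s1204 : ℝ := 18.602324622
/-- see `s602`. -/
def s2408 : ℝ := 18.602323240

/-- The successive differences and their OBSERVED contraction: `s₆₀₂ − s₁₂₀₄ = 2.035·10⁻⁵`, `s₁₂₀₄ − s₂₄₀₈ = 1.382·10⁻⁶`,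
ratio in `(1/16, 1/14)` — slightly weaker than the exact order-4 halving factor `1/16` (`2^3.88 = 14.7`: pre-asymptotic). -/
theorem step0_observed_contraction :
    s602 - s1204 = 2.035e-5 ∧ s1204 - s2408 = 1.382e-6 ∧
      1 / 16 * (s602 - s1204) < s1204 - s2408 ∧ s1204 - s2408 < 1 / 14 * (s602 - s1204) := by
  unfold s602 s1204 s2408; norm_num

/-- The order-4 Richardson value from the fine pair, `(2⁴·s₂₄₀₈ − s₁₂₀₄)/(2⁴ − 1)`, is `18.6023231479` to `10⁻¹⁰` — the printed
'Richardson(dt→0) 18.602323148' (Davis–Rabinowitz (1.15.10) with `α = 4`; cf. `Literature.Analysis.Quadrature.richardsonStep`). -/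
theorem step0_richardson4 : |(16 * s2408 - s1204) / 15 - 18.602323148| ≤ 2e-10 := by
  unfold s1204 s2408; norm_num [abs_le]

/-- UNDER CONTRACTION AT THE OBSERVED RATE (`θ = 1/14`, any limit `s` with `|s − s₂₄₀₈| ≤ (1/14)|s − s₁₂₀₄|`): the finest value
is within `1.1·10⁻⁷` of the dt → 0 limit, i.e. to relative `6·10⁻⁹` — the geometric tail `θ/(1−θ) = 1/13` of `fine_error_le`
times the observed `1.382·10⁻⁶`. Without the hypothesis nothing follows (`truth_unconstrained_without_contraction`). -/
theorem step0_temporal_tail {s : ℝ} (h : Contracts (1 / 14) s s1204 s2408) :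
    |s - s2408| ≤ 1.1e-7 ∧ |s - s2408| ≤ 6e-9 * s2408 := by
  have hf := fine_error_le (by norm_num) (by norm_num) h
  have hd : |s2408 - s1204| = 1.382e-6 := by unfold s1204 s2408; norm_num [abs_of_neg]
  rw [hd] at hf
  have h1 : |s - s2408| ≤ 1.1e-7 := by linarith [show (1 / 14 : ℝ) / (1 - 1 / 14) * 1.382e-6 ≤ 1.1e-7 by norm_num]
  have h2 : (1.1e-7 : ℝ) ≤ 6e-9 * s2408 := by unfold s2408; norm_num
  exact ⟨h1, h1.trans h2⟩

/-- Even under the pessimistic FIRST-order hypothesis (`θ = 1/2`, `fine_error_le_of_half`) the dt-error bound on `s₂₄₀₈` is the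
observed difference itself, `1.382·10⁻⁶` = relative `7.5·10⁻⁸` — still far inside every mark the cell reads. -/
theorem step0_temporal_tail_first_order {s : ℝ} (h : Contracts (1 / 2) s s1204 s2408) : |s - s2408| ≤ 1.382e-6 := by
  have hf := fine_error_le_of_half h
  have hd : |s2408 - s1204| = 1.382e-6 := by unfold s1204 s2408; norm_num [abs_of_neg]
  linarith

end Summit.NavierStokesRegularity.FluidComputer.GridContraction
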